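import Summits.Ventures.PercRepro.OrbitK
import Summits.Ventures.PercRepro.LemmaBPlusMask

/-!
# PercRepro — `not_C023Upper`: the `k ≥ 8` extension of ORBIT-k is false (typer-2, gen 7)

mine-4 (g5, 14:32:42Z; `data/mine-4/g5/C023-K8-WITNESS.md`, kit j164209 + an independent Python brute force;
re-derived by typer-2 with its own union-find brute force): on the 9-vertex graph `g9` = the 6-cycle
`0-1-5-3-4-2-0` through the UNMARKED hub `0` plus the three pendant edges `0-6`, `0-7`, `0-8`, with the marks
`1, …, 8` (`k = 8`), the full cube (`I = ⊥`, `D = ⊤`) and the pair `(2, 7)` (`i + j = k + 1`, constant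
`Φ(6, 1) = 16`): `Σ_{2<l<7} c_l = 86 + 128 + 129 + 86 = 429 < κ(2, 7; 8) · a_27 = 16 · 27 = 432`.
This file re-derives the numbers in the kernel and refutes `C023Upper` (OrbitK.lean — the `k ≥ 8` refinement
«the three-family constant for every `k` on the pairs with `i + j ≥ k`»; NOT the row of record `C023`, `k ≤ 7`,
which stands: CONJECTURES v150).

* `markClassesR` — the mark classes of a configuration CODE counted as the distinct reach masks (typer-1's bitmask
  connectivity `reachMask`, LemmaBPlusMask.lean) of the marks, reduced mod `2 ^ n`; `reachMask_mod_eq_iff` (two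
  marks have the same reduced reach mask iff they are connected — `connM_eq_connD`, p6's `connD_eq_decide`,
  `Nat.eq_of_testBit_eq`), `markClassesR_eq` (= `markClasses (cfgOf k c)`); `compl_cfgOf` (the antipode on the
  full cube is the bitwise complement of the code); **`antipodalCount_top`** / **`intervalCount_top`** — on the full
  cube the counts are sums of indicators over the `2 ^ k` codes (typer-1's `sum_cfgOf`).
* `g9`, `m8` — the witness; `ind5` / `contrib9` (the five indicators of one code from its two class counts),
  `sliceSum` + **`g9_slice0` … `g9_slice3`** (4 slices of 128 codes by `decide +kernel`, each inside the
  default heartbeats), **`g9_total`** (`(a_27, c_3, c_4, c_5, c_6) = (27, 86, 128, 129, 86)`), hence **`g9_a27`**,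
  **`g9_c3` … `g9_c6`**; `kappaK_two_seven_eight` (`κ(2, 7; 8) = 16`).
* **`not_C023Upper : ¬ C023Upper`**.
-/

namespace PercRepro

open Finset

namespace MultiGraph

variable {n k : ℕ} (G : MultiGraph (Fin n) (Fin k))

/-- The reach mask of a vertex, reduced to its `n` low bits. -/
def classMask (c : ℕ) (x : Fin n) : ℕ := G.reachMask c x % 2 ^ n

/-- A bit below `n` of the reduced reach mask is mask connectivity. -/
theorem testBit_classMask (c : ℕ) (x y : Fin n) : (G.classMask c x).testBit y.val = G.connM c x y := by
  unfold classMask connM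
  rw [Nat.testBit_mod_two_pow, decide_eq_true y.isLt, Bool.true_and]

/-- Mask connectivity is connectivity on the code configuration. -/
theorem connM_eq_true_iff (c : ℕ) (x y : Fin n) : G.connM c x y = true ↔ G.Conn (cfgOf k c) x y := by
  rw [G.connM_eq_connD, G.connD_eq_decide, decide_eq_true_iff]

/-- **Two vertices have the same reduced reach mask iff they are connected** in the code configuration. -/
theorem classMask_eq_iff (c : ℕ) (x y : Fin n) :
    G.classMask c x = G.classMask c y ↔ G.Conn (cfgOf k c) x y := by
  constructor
  · intro h
    have hy : G.connM c y y = true := (G.connM_eq_true_iff c y y).mpr (Conn.refl G _ y)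
    rw [← G.testBit_classMask, ← h, G.testBit_classMask, G.connM_eq_true_iff] at hy
    exact hy
  · intro h
    apply Nat.eq_of_testBit_eq
    intro i
    by_cases hi : i < n
    · have hx := G.testBit_classMask c x ⟨i, hi⟩
      have hy := G.testBit_classMask c y ⟨i, hi⟩
      simp only at hx hy
      rw [hx, hy, Bool.eq_iff_iff, G.connM_eq_true_iff, G.connM_eq_true_iff]
      exact ⟨fun h' => Conn.trans (Conn.symm h) h', fun h' => Conn.trans h h'⟩
    · unfold classMask
      rw [Nat.testBit_mod_two_pow, Nat.testBit_mod_two_pow, decide_eq_false hi, Bool.false_and,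
        Bool.false_and]

/-- The mark classes of the configuration code `c`: the distinct reduced reach masks of the marks. -/
def markClassesR (c : ℕ) {r : ℕ} (m : Fin r → Fin n) : ℕ := (univ.image fun i : Fin r => G.classMask c (m i)).card

/-- The set of marks whose vertex bit is set in a mask. -/
def classOfMask {r : ℕ} (m : Fin r → Fin n) (s : ℕ) : Finset (Fin r) :=
  univ.filter fun j : Fin r => s.testBit (m j).val = true

/-- The class of the mark `i` is `classOfMask` of its reduced reach mask. -/
theorem filter_conn_eq_classOfMask (c : ℕ) {r : ℕ} (m : Fin r → Fin n) (i : Fin r) :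
    (univ.filter fun j : Fin r => G.Conn (cfgOf k c) (m i) (m j)) = classOfMask m (G.classMask c (m i)) := by
  unfold classOfMask
  refine Finset.filter_congr fun j _ => ?_
  rw [G.testBit_classMask, G.connM_eq_true_iff]

/-- `classOfMask` is injective on the reduced reach masks of the marks. -/
theorem classOfMask_injOn (c : ℕ) {r : ℕ} (m : Fin r → Fin n) :
    Set.InjOn (classOfMask m) ((univ : Finset (Fin r)).image fun i => G.classMask c (m i)) := by
  intro s hs t ht hst
  simp only [Finset.coe_image, Finset.coe_univ, Set.image_univ, Set.mem_range] at hs ht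
  obtain ⟨i, rfl⟩ := hs
  obtain ⟨i', rfl⟩ := ht
  have hmem : i' ∈ classOfMask m (G.classMask c (m i')) := by
    unfold classOfMask
    rw [Finset.mem_filter, G.testBit_classMask]
    exact ⟨Finset.mem_univ _, (G.connM_eq_true_iff c _ _).mpr (Conn.refl G _ _)⟩
  rw [← hst] at hmem
  unfold classOfMask at hmem
  rw [Finset.mem_filter, G.testBit_classMask, G.connM_eq_true_iff] at hmem
  exact (G.classMask_eq_iff c _ _).mpr hmem.2

/-- **`markClassesR c m` is `markClasses (cfgOf k c) m`.** -/
theorem markClassesR_eq (c : ℕ) {r : ℕ} (m : Fin r → Fin n) :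
    G.markClassesR c m = G.markClasses (cfgOf k c) m := by
  unfold markClassesR markClasses
  have h1 : (univ.image fun i : Fin r => univ.filter fun j : Fin r => G.Conn (cfgOf k c) (m i) (m j)) =
      (univ.image fun i : Fin r => G.classMask c (m i)).image (classOfMask m) := by
    rw [Finset.image_image]
    exact Finset.image_congr fun i _ => G.filter_conn_eq_classOfMask c m i
  rw [h1, Finset.card_image_of_injOn (G.classOfMask_injOn c m)]

/-- The complement of a code configuration is the code with the `k` low bits flipped. -/
theorem compl_cfgOf (k a : ℕ) : (cfgOf k a)ᶜ = cfgOf k ((2 ^ k - 1) ^^^ a) := by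
  funext e
  simp only [Pi.compl_apply, cfgOf, Nat.testBit_xor, Nat.testBit_two_pow_sub_one, e.isLt, decide_true,
    Bool.true_xor, Bool.compl_eq_bnot]

/-- The `a_ij` indicator of a code on the full cube: `N(A) = i ∧ N(Aᶜ) = j`. -/
def antipodalInd {r : ℕ} (m : Fin r → Fin n) (i j a : ℕ) : ℕ :=
  if G.markClassesR a m = i ∧ G.markClassesR ((2 ^ k - 1) ^^^ a) m = j then 1 else 0

/-- The `c_l` indicator of a code on the full cube: `N(A) = l`. -/
def intervalInd {r : ℕ} (m : Fin r → Fin n) (l a : ℕ) : ℕ := if G.markClassesR a m = l then 1 else 0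

/-- On the full cube `[⊥, ⊤]`, `a_ij` is the sum of the indicators over the codes `a < 2 ^ k`. -/
theorem antipodalCount_top {r : ℕ} (m : Fin r → Fin n) (i j : ℕ) :
    G.antipodalCount m ⊥ ⊤ i j = ∑ a : Fin (2 ^ k), G.antipodalInd m i j a.val := by
  unfold antipodalCount antipodalInd
  rw [Finset.card_filter, ← MultiGraph.sum_cfgOf]
  refine Finset.sum_congr rfl fun a _ => ?_
  simp only [le_top, true_and, bot_sup_eq, top_inf_eq, compl_cfgOf, markClassesR_eq]

/-- On the full cube `[⊥, ⊤]`, `c_l` is the sum of the indicators over the codes `a < 2 ^ k`. -/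
theorem intervalCount_top {r : ℕ} (m : Fin r → Fin n) (l : ℕ) :
    G.intervalCount m ⊥ ⊤ l = ∑ a : Fin (2 ^ k), G.intervalInd m l a.val := by
  unfold intervalCount intervalInd
  rw [Finset.card_filter, ← MultiGraph.sum_cfgOf]
  refine Finset.sum_congr rfl fun a _ => ?_
  simp only [le_top, true_and, bot_sup_eq, markClassesR_eq]

end MultiGraph

/-! ### mine-4's witness -/

/-- The witness graph: vertices `0..8`, edges `0-1, 0-2, 0-6, 0-7, 0-8, 1-5, 2-4, 3-4, 3-5` — the 6-cycle
`0-1-5-3-4-2-0` through the hub `0` plus the pendants `0-6`, `0-7`, `0-8`. -/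
def g9 : MultiGraph (Fin 9) (Fin 9) :=
  ⟨![0, 0, 0, 0, 0, 1, 2, 3, 3], ![1, 2, 6, 7, 8, 5, 4, 4, 5]⟩

/-- The marks `1, …, 8` (the hub `0` is unmarked). -/
def m8 : Fin 8 → Fin 9 := ![1, 2, 3, 4, 5, 6, 7, 8]

/-- The five indicators `(a_27, c_3, c_4, c_5, c_6)` from the class counts `x = N(A)`, `y = N(Aᶜ)`. -/
def ind5 (x y : ℕ) : ℕ × ℕ × ℕ × ℕ × ℕ :=
  (if x = 2 ∧ y = 7 then 1 else 0, if x = 3 then 1 else 0, if x = 4 then 1 else 0, if x = 5 then 1 else 0,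
    if x = 6 then 1 else 0)

/-- The `(a_27, c_3, c_4, c_5, c_6)` contribution of the code `a` (each class count computed once). -/
def contrib9 (a : ℕ) : ℕ × ℕ × ℕ × ℕ × ℕ :=
  ind5 (g9.markClassesR a m8) (g9.markClassesR ((2 ^ 9 - 1) ^^^ a) m8)

/-- The first component of `contrib9` is the `a_27` indicator. -/
theorem contrib9_a27 (a : ℕ) : (contrib9 a).1 = g9.antipodalInd m8 2 7 a := by
  simp only [contrib9, ind5, MultiGraph.antipodalInd]

/-- The second component of `contrib9` is the `c_3` indicator. -/
theorem contrib9_c3 (a : ℕ) : (contrib9 a).2.1 = g9.intervalInd m8 3 a := by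
  simp only [contrib9, ind5, MultiGraph.intervalInd]

/-- The third component of `contrib9` is the `c_4` indicator. -/
theorem contrib9_c4 (a : ℕ) : (contrib9 a).2.2.1 = g9.intervalInd m8 4 a := by
  simp only [contrib9, ind5, MultiGraph.intervalInd]

/-- The fourth component of `contrib9` is the `c_5` indicator. -/
theorem contrib9_c5 (a : ℕ) : (contrib9 a).2.2.2.1 = g9.intervalInd m8 5 a := by
  simp only [contrib9, ind5, MultiGraph.intervalInd]

/-- The fifth component of `contrib9` is the `c_6` indicator. -/
theorem contrib9_c6 (a : ℕ) : (contrib9 a).2.2.2.2 = g9.intervalInd m8 6 a := by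
  simp only [contrib9, ind5, MultiGraph.intervalInd]

/-- The contributions of the codes in `[lo, hi)`. -/
def sliceSum (lo hi : ℕ) : ℕ × ℕ × ℕ × ℕ × ℕ := ∑ a ∈ Finset.Ico lo hi, contrib9 a

/-- Consecutive slices add. -/
theorem sliceSum_add {a b c : ℕ} (hab : a ≤ b) (hbc : b ≤ c) :
    sliceSum a b + sliceSum b c = sliceSum a c :=
  Finset.sum_Ico_consecutive _ hab hbc

set_option maxRecDepth 20000 in
/-- Slice 0: the codes `[0, 128)` of the full cube of `g9`. -/
theorem g9_slice0 : sliceSum 0 128 = (0, 7, 21, 35, 36) := by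
  decide +kernel

set_option maxRecDepth 20000 in
/-- Slice 1: the codes `[128, 256)` of the full cube of `g9`. -/
theorem g9_slice1 : sliceSum 128 256 = (5, 21, 35, 36, 22) := by
  decide +kernel

set_option maxRecDepth 20000 in
/-- Slice 2: the codes `[256, 384)` of the full cube of `g9`. -/
theorem g9_slice2 : sliceSum 256 384 = (5, 21, 35, 36, 22) := by
  decide +kernel

set_option maxRecDepth 20000 in
/-- Slice 3: the codes `[384, 512)` of the full cube of `g9`. -/
theorem g9_slice3 : sliceSum 384 512 = (17, 37, 37, 22, 6) := by
  decide +kernel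

/-- **The full cube of `g9`: `(a_27, c_3, c_4, c_5, c_6) = (27, 86, 128, 129, 86)`** (4 slices of 128 codes). -/
theorem g9_total : sliceSum 0 512 = (27, 86, 128, 129, 86) := by
  rw [← sliceSum_add (a := 0) (b := 128) (c := 512) (by norm_num) (by norm_num),
    ← sliceSum_add (a := 128) (b := 256) (c := 512) (by norm_num) (by norm_num),
    ← sliceSum_add (a := 256) (b := 384) (c := 512) (by norm_num) (by norm_num),
    g9_slice0, g9_slice1, g9_slice2, g9_slice3]
  decide

/-- `a_27 = 27` on the full cube of `g9`. -/
theorem g9_a27 : ∑ a : Fin (2 ^ 9), g9.antipodalInd m8 2 7 a.val = 27 := by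
  rw [Fin.sum_univ_eq_sum_range (g9.antipodalInd m8 2 7) (2 ^ 9), Finset.range_eq_Ico,
    show (2 : ℕ) ^ 9 = 512 by norm_num]
  have h := congrArg Prod.fst g9_total
  rw [sliceSum, Prod.fst_sum] at h
  simpa only [contrib9_a27] using h

/-- `c_3 = 86` on the full cube of `g9`. -/
theorem g9_c3 : ∑ a : Fin (2 ^ 9), g9.intervalInd m8 3 a.val = 86 := by
  rw [Fin.sum_univ_eq_sum_range (g9.intervalInd m8 3) (2 ^ 9), Finset.range_eq_Ico,
    show (2 : ℕ) ^ 9 = 512 by norm_num]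
  have h := congrArg (fun t : ℕ × ℕ × ℕ × ℕ × ℕ => t.2.1) g9_total
  simp only [sliceSum, Prod.snd_sum, Prod.fst_sum] at h
  simpa only [contrib9_c3] using h

/-- `c_4 = 128` on the full cube of `g9`. -/
theorem g9_c4 : ∑ a : Fin (2 ^ 9), g9.intervalInd m8 4 a.val = 128 := by
  rw [Fin.sum_univ_eq_sum_range (g9.intervalInd m8 4) (2 ^ 9), Finset.range_eq_Ico,
    show (2 : ℕ) ^ 9 = 512 by norm_num]
  have h := congrArg (fun t : ℕ × ℕ × ℕ × ℕ × ℕ => t.2.2.1) g9_total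
  simp only [sliceSum, Prod.snd_sum, Prod.fst_sum] at h
  simpa only [contrib9_c4] using h

/-- `c_5 = 129` on the full cube of `g9`. -/
theorem g9_c5 : ∑ a : Fin (2 ^ 9), g9.intervalInd m8 5 a.val = 129 := by
  rw [Fin.sum_univ_eq_sum_range (g9.intervalInd m8 5) (2 ^ 9), Finset.range_eq_Ico,
    show (2 : ℕ) ^ 9 = 512 by norm_num]
  have h := congrArg (fun t : ℕ × ℕ × ℕ × ℕ × ℕ => t.2.2.2.1) g9_total
  simp only [sliceSum, Prod.snd_sum, Prod.fst_sum] at h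
  simpa only [contrib9_c5] using h

/-- `c_6 = 86` on the full cube of `g9`. -/
theorem g9_c6 : ∑ a : Fin (2 ^ 9), g9.intervalInd m8 6 a.val = 86 := by
  rw [Fin.sum_univ_eq_sum_range (g9.intervalInd m8 6) (2 ^ 9), Finset.range_eq_Ico,
    show (2 : ℕ) ^ 9 = 512 by norm_num]
  have h := congrArg (fun t : ℕ × ℕ × ℕ × ℕ × ℕ => t.2.2.2.2) g9_total
  simp only [sliceSum, Prod.snd_sum] at h
  simpa only [contrib9_c6] using h

/-- `Finset.Ioo 2 7 = {3, 4, 5, 6}`. -/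
theorem ioo_two_seven : Finset.Ioo 2 7 = {3, 4, 5, 6} := by decide

/-- `κ(2, 7; 8) = Φ(6, 1) = (21 + 35 + 35 + 21) / 7 = 16`. -/
theorem kappaK_two_seven_eight : kappaK 2 7 8 = 16 := by
  unfold kappaK phiK
  rw [show Finset.Ioo 1 6 = {2, 3, 4, 5} from by decide]
  norm_num [Finset.sum_insert, Finset.sum_singleton, show Nat.choose 7 2 = 21 by decide,
    show Nat.choose 7 3 = 35 by decide, show Nat.choose 7 4 = 35 by decide, show Nat.choose 7 5 = 21 by decide]

/-- **`C023Upper` is false**: mine-4's witness at `k = 8`, `(i, j) = (2, 7)`: `16 · 27 = 432 > 429`. (On the same cube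
the pair `(3, 6)` fails too — `κ(3, 6; 8) = Φ(5, 2) = 10/3`, `(10/3) · 79 > c_4 + c_5 = 257` — engine, mine-4, ref-2 and
typer-2's brute force agree; not re-derived in the kernel.) -/
theorem not_C023Upper : ¬ C023Upper := by
  intro h
  have hk := h g9 8 m8 ⊥ ⊤ (by simp) 2 7 (by norm_num) (by norm_num) (by norm_num) (by norm_num)
  unfold MultiGraph.OrbitK at hk
  rw [kappaK_two_seven_eight, g9.antipodalCount_top, g9_a27, ioo_two_seven,
    Finset.sum_insert (by decide), Finset.sum_insert (by decide), Finset.sum_insert (by decide),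
    Finset.sum_singleton, g9.intervalCount_top, g9.intervalCount_top, g9.intervalCount_top,
    g9.intervalCount_top, g9_c3, g9_c4, g9_c5, g9_c6] at hk
  norm_num at hk

end PercRepro
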